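import Summits.CriticalPhenomena.PercolationContinuityZ3.Theorems.Transplant.SkelPhiFaceRouteNumsY4
import Summits.CriticalPhenomena.PercolationContinuityZ3.Theorems.Transplant.SkelPhiParaRunClear
import Summits.CriticalPhenomena.PercolationContinuityZ3.Theorems.Transplant.SkelPhiFaceTargetMM2
import Summits.CriticalPhenomena.PercolationContinuityZ3.Theorems.Transplant.SkelPhiFaceSchedBoxes
import Summits.CriticalPhenomena.PercolationContinuityZ3.Theorems.Transplant.SkelPhiRectAt
import HarnessLib

/-!
# N1 ({±1} node), (F) inner route, part R5b-vii-y (hp-8 g35): **THE SMART CONSTRUCTOR OF THE PER-CENTRE NUMBERS AT A y′-FACE, v4** —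
# `FaceRunNumsY4 … c … σh (sgOf du) B …` (= `faceRunNums3_y_mk` for the v4 record under (L-F1) (ii) / (L-F5): hop side `σh` (the bridge `B`
# in `rootFrame φ c σh`, cross-link readings `hxaY/hxbY` in the two-sign shapes), and the two served seed-clearance fields DISCHARGED here —
# the along y′-run by the SIGNED α-floor on the side `s_h = sgOf du·σh` of the seed column (`hclrLo` when `s_h = 1`: the regions' transverse
# range stays above `Mz`; `hclrHi` when `s_h = −1`: below `−Mz` — p1-g13's recession lemma / `yRun_region_clear_alpha_lo/_hi`), the tangential
# x-run PER REGION by an α-floor `Mz < |b + yT 0|` over the region's along range OR by the LEVEL floor `U·Mz + U·(max|ybLo k| |ybHi k| + 1) ≤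
# |n·yT 1 − h·yT 0|` (`Skelφ.not_mem_seed_of_level_runX`, p312897: the tangential run sits one band above the contact, (L-F5)); `Mz` replaces
# `kb`); v3: `FaceRunNums3 … false c …` (target `targetMM`, habitat `farCore`) from: the run data `yL yT Nr N₃ σT` and the reading boxes, the contact's cell
# bounds (`Llo ≤ lev(z_c) ≤ Lhi`), the footprint-box choices tied to the cell (`flo/fhi/fw`, `glo/ghi/gw`), and the purely NUMERIC fields passed
# through; the constructor DISCHARGES every graph-geometric field: the run origins `cL, cT` (`exists_mem_graphBall_φ_eq`), the habitat conversion
# `hPlfoot` (`mem_farCore_of_footBox`), the target conversion `hMfoot` (`mem_targetMM_of_cellBox`), the zone clearance `hMZ`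
# (`disjoint_targetMM_of_near`), and the schedule boxes `hprism/hprismY/hlastc` (`SkelPhiFaceSchedBoxes`).
builds on p205010 (kernel theorem, internal audit signed; external expert review pending) — nothing in this file uses p205010; no claim about the open node.
Lane `prim-bschramm`, seat `prim-hp-8` (gen 35); helper file (`--supports stmt-CriticalPhenomena-4575 --as helper`).
* **`Skelφ.faceRunNumsY4_mk`** (supersedes `faceRunNums3_y_mk`, p305952).
[cite: KozmaNitzan2024, §4 Lemma 11 (pp. 22–23), Lemma 12 (pp. 23–25)] [cite: MartineauTassion2017, §4.3 Lemma 4.2]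
-/

noncomputable section

open scoped Classical

namespace Summit.CriticalPhenomena.PercolationContinuityZ3.Theorems.Transplant

namespace Skelφ

open Literature.Probability.Percolation Literature.Probability.LatticeModels SimpleGraph KNCells
open Literature.Probability.Percolation.KozmaNitzan
open Literature.Probability.Percolation.KozmaNitzan.Cells (oth oth_ne sgOf sgOf_sign stepVec_apply_fst eq_oth_of_ne oth_oth)
open KNLevels ChainPlanar ChainPara
open Literature.Barriers.CriticalPhenomena (graphBall mem_graphBall_self graphBall_mono)
open BoxProdZ2 (ConcRadiiG)
open TwoAxis.Para (modulus)

variable {V : Type} [DecidableEq V] {G : SimpleGraph V} [G.LocallyFinite] {φ : V → Site 2}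

/-- **THE SMART CONSTRUCTOR OF THE PER-CENTRE NUMBERS AT A y′-FACE, v4** (see the module docstring). -/
theorem faceRunNumsY4_mk (hstep : Steps G φ) (pr : FinePrm) (w₀ : V) {nL : ℕ} (hn : pr.n = nL) (hnL : 1 ≤ nL) (hvL : |pr.vα| ≤ nL)
    (hD : 0 < pr.D) (hlipψ : Lip G (pr.ψ φ w₀)) (hws : WeakSteps G (pr.ψ φ w₀))
    (P : PCells2) (Λ : ConcRadiiG) (b₀ : Fin 2 → ℕ) (a' : ℕ) (x : Site 2) (du : MDir) (j : ℕ) {L' : ℕ} (hL' : 1 ≤ L')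
    (hrM : L' ≤ Λ.rM a' (x + stepVec du)) {k₀ : ℤ} (hk₀ : 0 ≤ k₀) {r : ℕ} (c : V) (hcw : c ∈ graphBall G w₀ (Λ.rE a' x du - r))
    (hrE : r ≤ Λ.rE a' x du) (Mz : ℕ)
    -- the contact's cell, the footprint boxes tied to it
    {Llo Lhi wc : ℤ} (hLlo : Llo ≤ P.lev du x (pr.ψ φ w₀ c)) (hLhi : P.lev du x (pr.ψ φ w₀ c) ≤ Lhi)
    (hwc : |pr.ψ φ w₀ c (oth du.1) - P.cen x (oth du.1)| ≤ wc)
    {flo fhi fw : ℤ} (hflo : 5 * (P.r du.1 : ℤ) + 10 * P.s du.1 * j + 3 ≤ flo + Llo) (hfhi : fhi + Lhi ≤ 25 * P.r du.1 - 2)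
    (hfw : fw + wc + k₀ + 1 ≤ 5 * (P.r (oth du.1) : ℤ) - 3) {LLO LHI : Site 2}
    (hglo : ∀ i, P.cen (x + stepVec du) i - b₀ i + 2 ≤ LLO i + pr.ψ φ w₀ c i) (hghi : ∀ i, LHI i + pr.ψ φ w₀ c i ≤ P.cen (x + stepVec du) i + b₀ i - 2)
    {kpar kperp : ℤ} (hfR : flo ≤ -kpar ∧ kpar ≤ fhi ∧ kperp ≤ fw)
    -- the near zone
    (Zc : Finset V) {kZ : ℤ} (hZk : ∀ v ∈ Zc, |pr.ψ φ c v du.1| ≤ kZ) (hZfar : Lhi + kZ + 1 < 20 * (P.r du.1 : ℤ) - b₀ du.1)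
    -- the run data
    {σh : ℤ} (hσh : σh = 1 ∨ σh = -1) (B : BridgePrm) (ℓ' R's qB R'₃ qB₃ : ℕ) (hlay : (nL + pr.h.natAbs : ℕ) ≤ (nL : ℤ) * ℓ' + 1) (yL yT : Site 2)
    (Nr N₃ : ℕ) {σT : ℤ} (hσT : σT = 1 ∨ σT = -1) (PLO PHI YLO YHI : ℕ → Site 2)
    {paLo pbLo paHi pbHi yaLo ybLo yaHi ybHi : ℕ → ℤ} {laLo lbLo laHi lbHi : ℤ}
    (hreg : ∀ k ≤ Nr, (yRunSched hnL hvL hlay R's qB Nr).region k ⊆ Finset.Icc (pt (paLo k) (pbLo k)) (pt (paHi k) (pbHi k)))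
    (hregY : ∀ k ≤ N₃, (xRunSched nL ℓ' pr.h R'₃ qB₃ N₃).region k ⊆ Finset.Icc (pt (yaLo k) (ybLo k)) (pt (yaHi k) (ybHi k)))
    (hlastc : (xRunSched nL ℓ' pr.h R'₃ qB₃ N₃).core (N₃ + 1) ⊆ Finset.Icc (pt laLo lbLo) (pt laHi lbHi))
    (hP0 : ∀ k ≤ Nr, PLO k 0 ≤ TwoAxis.Para.coarse pr.c₀ (pr.D / 2) pr.D (TwoAxis.Para.lam0 pr.A pr.vα pr.vβ yL) +
      (pr.c₀ * (pr.A * (modulus nL pr.h pr.vα pr.vβ * (min (sgOf du * pbLo k) (sgOf du * pbHi k)) -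
      max (pr.vα * ((shearUnit nL pr.h : ℤ) * (min (sgOf du * paLo k) (sgOf du * paHi k) - 1)))
      (pr.vα * ((shearUnit nL pr.h : ℤ) * (max (sgOf du * paLo k) (sgOf du * paHi k)) + shearUnit nL pr.h - 1))) / nL)) / pr.D)
    (hP1 : ∀ k ≤ Nr, TwoAxis.Para.coarse pr.c₀ (pr.D / 2) pr.D (TwoAxis.Para.lam0 pr.A pr.vα pr.vβ yL) +
      (pr.c₀ * (pr.A * (modulus nL pr.h pr.vα pr.vβ * (max (sgOf du * pbLo k) (sgOf du * pbHi k)) -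
      min (pr.vα * ((shearUnit nL pr.h : ℤ) * (min (sgOf du * paLo k) (sgOf du * paHi k) - 1)))
      (pr.vα * ((shearUnit nL pr.h : ℤ) * (max (sgOf du * paLo k) (sgOf du * paHi k)) + shearUnit nL pr.h - 1))) / nL)) / pr.D
      + 1 ≤ PHI k 0)
    (hP2 : ∀ k ≤ Nr, PLO k 1 ≤ TwoAxis.Para.coarse pr.c₁ (pr.D / 2) pr.D (TwoAxis.Para.lam1 pr.A nL pr.h yL) +
      (pr.c₁ * (pr.A * ((shearUnit nL pr.h : ℤ) * (min (sgOf du * paLo k) (sgOf du * paHi k) - 1)))) / pr.D)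
    (hP3 : ∀ k ≤ Nr, TwoAxis.Para.coarse pr.c₁ (pr.D / 2) pr.D (TwoAxis.Para.lam1 pr.A nL pr.h yL) +
      (pr.c₁ * (pr.A * ((shearUnit nL pr.h : ℤ) * (max (sgOf du * paLo k) (sgOf du * paHi k)) + shearUnit nL pr.h - 1))) / pr.D + 1
      ≤ PHI k 1)
    (hPf₁ : ∀ k ≤ Nr, sgOf du = 1 → flo ≤ PLO k du.1 ∧ PHI k du.1 ≤ fhi)
    (hPf₂ : ∀ k ≤ Nr, sgOf du = -1 → flo ≤ -PHI k du.1 ∧ -PLO k du.1 ≤ fhi)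
    (hPf₃ : ∀ k ≤ Nr, -fw ≤ PLO k (oth du.1) ∧ PHI k (oth du.1) ≤ fw)
    (hY0 : ∀ k ≤ N₃, YLO k 0 ≤ TwoAxis.Para.coarse pr.c₀ (pr.D / 2) pr.D (TwoAxis.Para.lam0 pr.A pr.vα pr.vβ yT) +
      (pr.c₀ * (pr.A * (modulus nL pr.h pr.vα pr.vβ * (min (σT * yaLo k) (σT * yaHi k)) -
      max (pr.vα * ((shearUnit nL pr.h : ℤ) * (min (σT * ybLo k) (σT * ybHi k) - 1)))
      (pr.vα * ((shearUnit nL pr.h : ℤ) * (max (σT * ybLo k) (σT * ybHi k)) + shearUnit nL pr.h - 1))) / nL)) / pr.D)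
    (hY1 : ∀ k ≤ N₃, TwoAxis.Para.coarse pr.c₀ (pr.D / 2) pr.D (TwoAxis.Para.lam0 pr.A pr.vα pr.vβ yT) +
      (pr.c₀ * (pr.A * (modulus nL pr.h pr.vα pr.vβ * (max (σT * yaLo k) (σT * yaHi k)) -
      min (pr.vα * ((shearUnit nL pr.h : ℤ) * (min (σT * ybLo k) (σT * ybHi k) - 1)))
      (pr.vα * ((shearUnit nL pr.h : ℤ) * (max (σT * ybLo k) (σT * ybHi k)) + shearUnit nL pr.h - 1))) / nL)) / pr.D
      + 1 ≤ YHI k 0)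
    (hY2 : ∀ k ≤ N₃, YLO k 1 ≤ TwoAxis.Para.coarse pr.c₁ (pr.D / 2) pr.D (TwoAxis.Para.lam1 pr.A nL pr.h yT) +
      (pr.c₁ * (pr.A * ((shearUnit nL pr.h : ℤ) * (min (σT * ybLo k) (σT * ybHi k) - 1)))) / pr.D)
    (hY3 : ∀ k ≤ N₃, TwoAxis.Para.coarse pr.c₁ (pr.D / 2) pr.D (TwoAxis.Para.lam1 pr.A nL pr.h yT) +
      (pr.c₁ * (pr.A * ((shearUnit nL pr.h : ℤ) * (max (σT * ybLo k) (σT * ybHi k)) + shearUnit nL pr.h - 1))) / pr.D + 1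
      ≤ YHI k 1)
    (hYf₁ : ∀ k ≤ N₃, sgOf du = 1 → flo ≤ YLO k du.1 ∧ YHI k du.1 ≤ fhi)
    (hYf₂ : ∀ k ≤ N₃, sgOf du = -1 → flo ≤ -YHI k du.1 ∧ -YLO k du.1 ≤ fhi)
    (hYf₃ : ∀ k ≤ N₃, -fw ≤ YLO k (oth du.1) ∧ YHI k (oth du.1) ≤ fw)
    (hL0 : LLO 0 ≤ TwoAxis.Para.coarse pr.c₀ (pr.D / 2) pr.D (TwoAxis.Para.lam0 pr.A pr.vα pr.vβ yT) +
      (pr.c₀ * (pr.A * (modulus nL pr.h pr.vα pr.vβ * (min (σT * laLo) (σT * laHi)) -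
      max (pr.vα * ((shearUnit nL pr.h : ℤ) * (min (σT * lbLo) (σT * lbHi) - 1)))
      (pr.vα * ((shearUnit nL pr.h : ℤ) * (max (σT * lbLo) (σT * lbHi)) + shearUnit nL pr.h - 1))) / nL)) / pr.D)
    (hL1 : TwoAxis.Para.coarse pr.c₀ (pr.D / 2) pr.D (TwoAxis.Para.lam0 pr.A pr.vα pr.vβ yT) +
      (pr.c₀ * (pr.A * (modulus nL pr.h pr.vα pr.vβ * (max (σT * laLo) (σT * laHi)) -
      min (pr.vα * ((shearUnit nL pr.h : ℤ) * (min (σT * lbLo) (σT * lbHi) - 1)))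
      (pr.vα * ((shearUnit nL pr.h : ℤ) * (max (σT * lbLo) (σT * lbHi)) + shearUnit nL pr.h - 1))) / nL)) / pr.D
      + 1 ≤ LHI 0)
    (hL2 : LLO 1 ≤ TwoAxis.Para.coarse pr.c₁ (pr.D / 2) pr.D (TwoAxis.Para.lam1 pr.A nL pr.h yT) +
      (pr.c₁ * (pr.A * ((shearUnit nL pr.h : ℤ) * (min (σT * lbLo) (σT * lbHi) - 1)))) / pr.D)
    (hL3 : TwoAxis.Para.coarse pr.c₁ (pr.D / 2) pr.D (TwoAxis.Para.lam1 pr.A nL pr.h yT) +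
      (pr.c₁ * (pr.A * ((shearUnit nL pr.h : ℤ) * (max (σT * lbLo) (σT * lbHi)) + shearUnit nL pr.h - 1))) / pr.D + 1
      ≤ LHI 1)
    (hxaY : ∀ x ∈ Finset.Icc B.core1Lo B.core1Hi,
      -((((nL : ℤ) + pr.vα).toNat : ℕ) : ℤ) ≤ sgOf du * σh * x 0 - sgOf du * yL 0 ∧ sgOf du * σh * x 0 - sgOf du * yL 0 ≤ ((((nL : ℤ) - pr.vα).toNat : ℕ) : ℤ))
    (hxbY : ∀ x ∈ Finset.Icc B.core1Lo B.core1Hi,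
      |sgOf du * ((nL : ℤ) * (x 1 - yL 1) - pr.h * (σh * x 0 - yL 0))| + shearUnit nL pr.h ≤ ((qB : ℤ) + 1) * shearUnit nL pr.h)
    (hxyY : ∀ a s : ℤ, (yPrmW nL ℓ' pr.h pr.vα R's qB Nr).aLo (Nr + 1) ≤ s / (shearUnit nL pr.h : ℤ) →
      s / (shearUnit nL pr.h : ℤ) ≤ (yPrmW nL ℓ' pr.h pr.vα R's qB Nr).aHi (Nr + 1) →
      (yPrmW nL ℓ' pr.h pr.vα R's qB Nr).bLo (Nr + 1) ≤ a → a ≤ (yPrmW nL ℓ' pr.h pr.vα R's qB Nr).bHi (Nr + 1) →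
      (xPrmW nL ℓ' pr.h R'₃ qB₃ N₃).InCore 0 (σT * sgOf du * a - σT * (yT - yL) 0)
      ((σT * sgOf du * s - σT * ((nL : ℤ) * (yT - yL) 1 - pr.h * (yT - yL) 0)) / (shearUnit nL pr.h : ℤ)))
    -- seed clearances: along y′-run by the signed α-floor on the side `s_h = sgOf du·σh`; tangential x-run per region by α OR by level
    (hclrLo : sgOf du * σh = 1 → ∀ k ≤ Nr, (Mz : ℤ) < pbLo k + sgOf du * yL 0)
    (hclrHi : sgOf du * σh = -1 → ∀ k ≤ Nr, pbHi k + sgOf du * yL 0 < -(Mz : ℤ))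
    (hclr₃ : ∀ k ≤ N₃, (∀ b : ℤ, min (σT * yaLo k) (σT * yaHi k) ≤ b → b ≤ max (σT * yaLo k) (σT * yaHi k) → (Mz : ℤ) < |b + yT 0|) ∨
      ((shearUnit nL pr.h : ℤ) * Mz + (shearUnit nL pr.h : ℤ) * (max |ybLo k| |ybHi k| + 1) ≤ |(nL : ℤ) * yT 1 - pr.h * yT 0|))
    (hπ2Y : ∀ k ≤ Nr, ((yL 0).natAbs + (yL 1).natAbs) + (((((k + 1 : ℕ) : ℤ) * pr.vα).natAbs +
      (((shearUnit nL pr.h : ℤ) * |((k + 1 : ℕ) : ℤ) * (yPrmW nL ℓ' pr.h pr.vα R's qB Nr).sLo| + |pr.h| * |((k + 1 : ℕ) : ℤ) * pr.vα| + shearUnit nL pr.h) / nL).natAbs + 1))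
      ≤ r)
    (hπ3Y : ((yT 0).natAbs + (yT 1).natAbs) + (N₃ + 1) * shearUnit nL pr.h ≤ r)
    : Nonempty (FaceRunNumsY4 G φ (pr.ψ φ w₀) c pr.A nL pr.h pr.vα pr.vβ pr.c₀ pr.c₁ pr.D du σh (sgOf du) B ℓ' R's qB R'₃ qB₃ pr.vα hnL hvL hlay Mz
        (P.farCore x du j k₀) (targetMM G φ pr P w₀ Λ b₀ a' x du L') Zc r kpar kperp) := by
  have hσ : sgOf du = 1 ∨ sgOf du = -1 := sgOf_sign du
  have hσabs : |sgOf du| = 1 := by rcases hσ with h | h <;> simp [h]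
  have hsh : sgOf du * σh = 1 ∨ sgOf du * σh = -1 := by
    rcases hσ with h1 | h1 <;> rcases hσh with h2 | h2 <;> simp [h1, h2]
  -- the fine maps in the structure's spelling
  have eψ : ∀ t, pr.ψ φ t = fineSkel φ t pr.A (nL : ℤ) pr.h pr.vα pr.vβ pr.c₀ pr.c₁ (pr.D / 2) (pr.D / 2) pr.D := fun t => by
    simp only [FinePrm.ψ, hn]
  -- the run origins
  obtain ⟨cL, hcLπ, hcLφ⟩ := exists_mem_graphBall_φ_eq hstep c (φ c + yL)
  obtain ⟨cT, hcTπ, hcTφ⟩ := exists_mem_graphBall_φ_eq hstep c (φ c + yT)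
  simp only [Pi.add_apply, add_sub_cancel_left] at hcLπ hcTπ
  -- the inner ball inside the outer ball
  have hball : ∀ {w : V}, w ∈ graphBall G c r → w ∈ graphBall G w₀ (Λ.rE a' x du) := by
    intro w hw
    have h2 := BoxProdZ2.mem_graphBall_add G hcw hw
    rwa [Nat.sub_add_cancel hrE] at h2
  refine ⟨
    { cL := cL,
      cT := cT,
      yL := yL,
      yT := yT,
      RcL := (yL 0).natAbs + (yL 1).natAbs,
      RcT := (yT 0).natAbs + (yT 1).natAbs,
      Nr := Nr,
      N₃ := N₃,
      σT := σT,
      flo := flo,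
      fhi := fhi,
      fw := fw,
      paLo := paLo,
      pbLo := pbLo,
      paHi := paHi,
      pbHi := pbHi,
      PLO := PLO,
      PHI := PHI,
      yaLo := yaLo,
      ybLo := ybLo,
      yaHi := yaHi,
      ybHi := ybHi,
      laLo := laLo,
      lbLo := lbLo,
      laHi := laHi,
      lbHi := lbHi,
      YLO := YLO,
      YHI := YHI,
      LLO := LLO,
      LHI := LHI,
      hcLφ := hcLφ,
      hcTφ := hcTφ,
      hcLπ := hcLπ,
      hcTπ := hcTπ,
      hσT := hσT,
      hPlfoot := fun w _ hfb => ?_,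
      hMfoot := fun w hw hfb => ?_,
      hMZ := ?_,
      hfR := hfR,
      hreg := hreg,
      hregY := hregY,
      hlastc := hlastc,
      hP0 := hP0,
      hP1 := hP1,
      hP2 := hP2,
      hP3 := hP3,
      hPf₁ := hPf₁,
      hPf₂ := hPf₂,
      hPf₃ := hPf₃,
      hY0 := hY0,
      hY1 := hY1,
      hY2 := hY2,
      hY3 := hY3,
      hYf₁ := hYf₁,
      hYf₂ := hYf₂,
      hYf₃ := hYf₃,
      hL0 := hL0,
      hL1 := hL1,
      hL2 := hL2,
      hL3 := hL3,
      hxa := hxaY,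
      hxb := hxbY,
      hxy := hxyY,
      hclrA := fun S hS k hk w hw hwS => ?_,
      hclrT := fun S hS k hk w hw => ?_,
      hπ2 := hπ2Y,
      hπ3 := hπ3Y }⟩
  · -- habitat conversion
    rw [eψ w₀]
    rw [eψ w₀] at hwc hLlo hLhi
    exact mem_farCore_of_footBox P w₀ c w pr.A (nL : ℤ) pr.h pr.vα pr.vβ pr.c₀ pr.c₁ hD hk₀ hfb hwc (by linarith) (by linarith) (by linarith)
  · -- target conversion
    rw [← eψ c] at hfb
    exact mem_targetMM_of_cellBox c hL' hrM hD hlipψ hws (hball hw) hfb hglo hghi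
  · -- the target is off the zone
    exact disjoint_targetMM_of_near c hD hZk hLhi hZfar
  · -- the along y′-run is α-clear of the seed, on the side `s_h` of the seed column
    have hb := hreg k hk hw
    rw [mem_Icc_pt_iff] at hb
    have h1 := hb.2.1
    have h2 := hb.2.2
    rw [runY_one, relCoord_apply, hcLφ, Pi.add_apply] at h1 h2
    have hs := hS w hwS
    rw [mem_box] at hs
    have hs0 := hs 0
    simp only [Pi.sub_apply] at hs0
    have ha : |sgOf du * (φ w 0 - φ c 0)| ≤ Mz := by rw [abs_mul, hσabs, one_mul]; exact abs_le.2 ⟨hs0.1, hs0.2⟩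
    have ha' := abs_le.1 ha
    have e : sgOf du * (φ w 0 - (φ c 0 + yL 0)) = sgOf du * (φ w 0 - φ c 0) - sgOf du * yL 0 := by ring
    rw [e] at h1 h2
    rcases hsh with hsg | hsg
    · have hck := hclrLo hsg k hk
      linarith
    · have hck := hclrHi hsg k hk
      linarith
  · -- the tangential x-run is clear of the seed, region by region: by α or by level
    have hb := hregY k hk hw
    rw [mem_Icc_pt_iff] at hb
    rcases hclr₃ k hk with hα | hlev
    · intro hwS
      have hs := hS w hwS
      rw [mem_box] at hs
      have hs0 := hs 0
      simp only [Pi.sub_apply] at hs0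
      have ha : |φ w 0 - φ c 0| ≤ Mz := abs_le.2 ⟨hs0.1, hs0.2⟩
      have h1 := hb.1.1
      have h2 := hb.1.2
      rw [runX_zero, relCoord_apply] at h1 h2
      have key : (Mz : ℤ) < |(φ w 0 - φ cT 0) + yT 0| := by
        refine hα (φ w 0 - φ cT 0) ?_ ?_
        · rcases hσT with hT | hT <;> subst hT
          · exact (min_le_left _ _).trans (by linarith)
          · exact (min_le_right _ _).trans (by linarith)
        · rcases hσT with hT | hT <;> subst hT
          · exact le_trans (by linarith) (le_max_right _ _)
          · exact le_trans (by linarith) (le_max_left _ _)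
      rw [hcTφ, Pi.add_apply] at key
      have e : φ w 0 - (φ c 0 + yT 0) + yT 0 = φ w 0 - φ c 0 := by ring
      rw [e] at key
      linarith
    · refine not_mem_seed_of_level_runX hS hnL cT pr.h hσT (H := |(nL : ℤ) * yT 1 - pr.h * yT 0|) (le_of_eq ?_)
        (abs_le_max_abs_abs hb.2.1 hb.2.2) hlev
      rw [shearCoord_apply, hcTφ, Pi.add_apply, Pi.add_apply]
      congr 1; ring

end Skelφ

end Summit.CriticalPhenomena.PercolationContinuityZ3.Theorems.Transplant

end
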